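import Summits.QuantumFields.YangMills.Theorems.FluctuationComparisonRegPrIntLS2BetaCritMOfSubmersion
import HarnessLib

/-!
# S2β · (SUBM-m) CONJUNCT (s3) — «THE LEVEL SET OF A CHARTED DESCENT LIES IN THE CHARTED FIBRE NEAR THE BASE POINT»: for `Mc = χ ∘ g` with the target chart `χ`
# injective near `g 0` and `g` continuous at `0`, `Mc ζ = Mc 0 ⟹ g ζ = g 0` for `ζ` near `0`; organ instance `g ζ := D_{J,K}(expPoint(ζ)•U₀)`, `U₀ ∈ fibre(V)` ⟹ the
# `hfib` hypothesis of ✓p823424 `…CritMOfSubmersion.exists_multiplier_of_subm` [folklore topology]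

Cell `ym3-torus` (YM ladder rung R3 = continuum `SU(2)` Yang–Mills on the three-torus at fixed lattice data — a RUNG: NOT d = 4, NOT infinite volume, NOT a mass gap,
NOT Clay).  Width seat `ym3-torus-px5` (gen 22); crux `stmt-QuantumFields-20520`, LINE g18-1 S2β, (F♮)∕«CRIT» lane (holder px16 g21): CRIT-m♮ ⟸ ✓p823424 ⟸ (SUBM-m) =
{(s1) strict derivative of the charted descent — px13 g25 FILE A∕B over ✓N09, (s2) onto — px13 g25, (s3) THIS FILE}; `--kind proof --supports stmt-QuantumFields-20520 --as helper`,
count-neutral, DEFINITION-FREE (0 `def`, 0 `instance`, 0 `notation`, 0 `sorry`, default heartbeats).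

WHAT IS PROVED (sorry-free).
* §1 generic [folklore]: ★`exists_nhds_eq_of_injOn_comp` — topological spaces `X Z`, any `Y`; `g : X → Z` continuous at `x₀`, `χ : Z → Y` injective on some `O ∈ 𝓝 (g x₀)` ⟹
  `∃ N ∈ 𝓝 x₀, ∀ x ∈ N, χ (g x) = χ (g x₀) → g x = g x₀`.
* §2 organ instance: ★★`hfib_of_continuousAt_of_injOn` — for `U₀ ∈ fibre F ℰp J K hJK V`, a target chart `χ` on the level-`J` fields injective on a neighbourhood of `V`, and
  `ζ ↦ D_{J,K}(expPoint(ζ)•U₀)` continuous at `0`: the `hfib` hypothesis of ✓p823424 for `Mc := χ ∘ D_{J,K} ∘ chart_{U₀}` —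
  `∃ N ∈ 𝓝 0, ∀ ζ ∈ N, Mc ζ = Mc 0 → expPoint(ζ)•U₀ ∈ fibre F ℰp J K hJK V`; ★★`exists_multiplier_of_chart` — ✓p823424 `exists_multiplier_of_subm` with (s3) DISCHARGED: inputs
  = fibre-local minimum + (s1) + (s2) + `χ` locally injective + continuity of the charted descent.

HONEST.  Topology bookkeeping; nothing of Bałaban's; (s1), (s2), RINV-cov, AVG₂♭-ax, MULT♮, «CRIT-ax», (D-ax)∕(F-ax), GAP♯∘, the five REGISTERED stubs, S2β, crux 20520, 19936,
19200 and `YM3TorusSU2` are NOT proved; no summit statement is proved by a helper; rung R3 = SU(2) YM₃ on T³ at fixed lattice data — NOT d = 4, NOT infinite volume, NOT a mass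
gap, NOT Clay; the Yang–Mills mass gap is NOT proved.  [folklore]
-/

set_option autoImplicit false

noncomputable section

open scoped Topology
open Filter Set
open Literature.MathematicalPhysics.QuantumLattice (su2Quat)
open Literature.MathematicalPhysics.QuantumFieldTheory.Balaban1983to89
open Literature.MathematicalPhysics.QuantumFieldTheory.Balaban1983to89.T3ContinuumYM3Torus
open Literature.MathematicalPhysics.QuantumFieldTheory.Balaban1983to89.T3UnitLawDensityEML (ℰp)
open Literature.MathematicalPhysics.QuantumFieldTheory.Balaban1983to89.T3UnitScaleTilt
open Literature.MathematicalPhysics.QuantumFieldTheory.Balaban1983to89.T3TiltDescent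
open Literature.MathematicalPhysics.QuantumFieldTheory.Balaban1983to89.T3ConstrainedMinimiser (fibre)
open Literature.MathematicalPhysics.QuantumFieldTheory.Balaban1983to89.T3DescentFibreTower
open Literature.MathematicalPhysics.QuantumFieldTheory.Balaban1983to89.T4CubeChartGnomonic (SU2)
open Literature.MathematicalPhysics.QuantumFieldTheory.Balaban1983to89.T4HaarSU2ExpChart (expPoint)
open Literature.MathematicalPhysics.QuantumFieldTheory.Balaban1983to89.T4ExpWindowSmallField (imVec)
open Literature.MathematicalPhysics.QuantumFieldTheory.Balaban1983to89.B15Prop1ChartSU2 (adSU2)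
open Literature.MathematicalPhysics.QuantumFieldTheory.Balaban1983to89.T4Continuum
open Summit.QuantumFields.YangMills.Theorems.FluctuationComparisonRegPrIntLS2BetaCritMOfSubmersion (exists_multiplier_of_subm chart_zero)

namespace Summit.QuantumFields.YangMills.Theorems.FluctuationComparisonRegPrIntLS2BetaChartedFibreLevelSet

/-! ## §1 Generic: a locally injective target chart does not create level-set points near the base -/

section Generic

variable {X Z Y : Type*} [TopologicalSpace X] [TopologicalSpace Z]

/-- ★ If `g` is continuous at `x₀` and `χ` is injective on a neighbourhood of `g x₀`, then near `x₀` the level set of `χ ∘ g` through `x₀` is the level set of `g`. [folklore] -/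
theorem exists_nhds_eq_of_injOn_comp {g : X → Z} {χ : Z → Y} {x₀ : X} {O : Set Z}
    (hg : ContinuousAt g x₀) (hO : O ∈ 𝓝 (g x₀)) (hχ : InjOn χ O) :
    ∃ N ∈ 𝓝 x₀, ∀ x ∈ N, χ (g x) = χ (g x₀) → g x = g x₀ := by
  refine ⟨g ⁻¹' O, hg.preimage_mem_nhds hO, fun x hx h => ?_⟩
  exact hχ hx (mem_of_mem_nhds hO) h

end Generic

/-! ## §2 The organ instance: `hfib` of ✓p823424 from continuity of the charted descent and local injectivity of the target chart -/

section Organ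

variable {F : T3Family}

/-- ★★ **(s3) FOR THE ORGAN**: if `U₀` lies in the descent fibre of `V`, the charted descent `ζ ↦ D_{J,K}(expPoint(ζ)•U₀)` is continuous at `0`, and the target chart `χ` is
injective on a neighbourhood of `V`, then for `ζ` near `0`, `χ (D_{J,K}(expPoint(ζ)•U₀)) = χ (D_{J,K}(expPoint(0)•U₀))` forces `expPoint(ζ)•U₀ ∈ fibre F ℰp J K hJK V` — the `hfib`
hypothesis of ✓`…CritMOfSubmersion.exists_multiplier_of_subm` for `Mc := χ ∘ D_{J,K} ∘ chart_{U₀}`. [folklore] -/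
theorem hfib_of_continuousAt_of_injOn {J K : ℕ} (hJK : J ≤ K) {V : GaugeField (F.P J) 0 SU2} {U₀ : GaugeField (F.P K) 0 SU2}
    (hU₀ : U₀ ∈ fibre F ℰp J K hJK V) {Y : Type*} {χ : GaugeField (F.P J) 0 SU2 → Y} {O : Set (GaugeField (F.P J) 0 SU2)}
    (hO : O ∈ 𝓝 V) (hχ : InjOn χ O)
    (hcont : ContinuousAt (fun ζ : PBond (F.P K) 0 → EuclideanSpace ℝ (Fin 3) =>
      descendTo F ℰp J K hJK (fun ℓ => expPoint (ζ ℓ) * U₀ ℓ : GaugeField (F.P K) 0 SU2)) 0) :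
    ∃ N ∈ 𝓝 (0 : PBond (F.P K) 0 → EuclideanSpace ℝ (Fin 3)), ∀ ζ ∈ N,
      (fun ζ' : PBond (F.P K) 0 → EuclideanSpace ℝ (Fin 3) => χ (descendTo F ℰp J K hJK (fun ℓ => expPoint (ζ' ℓ) * U₀ ℓ : GaugeField (F.P K) 0 SU2))) ζ =
        (fun ζ' : PBond (F.P K) 0 → EuclideanSpace ℝ (Fin 3) => χ (descendTo F ℰp J K hJK (fun ℓ => expPoint (ζ' ℓ) * U₀ ℓ : GaugeField (F.P K) 0 SU2))) 0 →
      (fun ℓ => expPoint (ζ ℓ) * U₀ ℓ : GaugeField (F.P K) 0 SU2) ∈ fibre F ℰp J K hJK V := by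
  have h0 : descendTo F ℰp J K hJK (fun ℓ => expPoint ((0 : PBond (F.P K) 0 → EuclideanSpace ℝ (Fin 3)) ℓ) * U₀ ℓ : GaugeField (F.P K) 0 SU2) = V := by
    rw [chart_zero U₀]
    exact (mem_fibre_iff F ℰp).mp hU₀
  have hO' : O ∈ 𝓝 (descendTo F ℰp J K hJK (fun ℓ => expPoint ((0 : PBond (F.P K) 0 → EuclideanSpace ℝ (Fin 3)) ℓ) * U₀ ℓ : GaugeField (F.P K) 0 SU2)) := by
    rw [h0]; exact hO
  obtain ⟨N, hN, h⟩ := exists_nhds_eq_of_injOn_comp hcont hO' hχ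
  refine ⟨N, hN, fun ζ hζ heq => ?_⟩
  have hg := h ζ hζ heq
  rw [h0] at hg
  exact (mem_fibre_iff F ℰp).mpr hg

/-- ★★ **CRIT-m♮ ⟸ (s1) ∧ (s2) for a chart `Mc = χ ∘ D_{J,K} ∘ chart_{U₀}`** ((s3) discharged by `hfib_of_continuousAt_of_injOn`): a fibre-local minimum `U₀` (✓(β)), a target chart
`χ` injective near `V`, the charted descent continuous at `0`, `Mc` strictly differentiable at `0` with ONTO derivative `DM` ⟹ `∃ λ, ∀ ζ, DA(U₀)[ζ] = λ (DM ζ)`.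
[cite: Balaban1985Variational, (26) p.282, (171) p.305] -/
theorem exists_multiplier_of_chart {J K : ℕ} (hJK : J ≤ K) {V : GaugeField (F.P J) 0 SU2} (U₀ : GaugeField (F.P K) 0 SU2)
    (hU₀ : U₀ ∈ fibre F ℰp J K hJK V)
    (hloc : IsLocalMinOn (fun W : GaugeField (F.P K) 0 SU2 => wilsonAction4 W) (fibre F ℰp J K hJK V) U₀)
    {Y : Type*} [NormedAddCommGroup Y] [NormedSpace ℝ Y] [CompleteSpace Y]
    {χ : GaugeField (F.P J) 0 SU2 → Y} {O : Set (GaugeField (F.P J) 0 SU2)} (hO : O ∈ 𝓝 V) (hχ : InjOn χ O)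
    (hcont : ContinuousAt (fun ζ : PBond (F.P K) 0 → EuclideanSpace ℝ (Fin 3) =>
      descendTo F ℰp J K hJK (fun ℓ => expPoint (ζ ℓ) * U₀ ℓ : GaugeField (F.P K) 0 SU2)) 0)
    {DM : (PBond (F.P K) 0 → EuclideanSpace ℝ (Fin 3)) →L[ℝ] Y}
    (hMc : HasStrictFDerivAt (fun ζ : PBond (F.P K) 0 → EuclideanSpace ℝ (Fin 3) =>
      χ (descendTo F ℰp J K hJK (fun ℓ => expPoint (ζ ℓ) * U₀ ℓ : GaugeField (F.P K) 0 SU2))) DM 0)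
    (hsurj : Function.Surjective DM) :
    ∃ lam : Y → ℝ, ∀ ζ : PBond (F.P K) 0 → EuclideanSpace ℝ (Fin 3),
      (∑ p : Plaq (F.P K) 0, inner ℝ (imVec (su2Quat (GaugeField.plaqHol U₀ p)))
        (adSU2 (GaugeField.plaqHol U₀ p)⁻¹ (ζ ⟨p.src, p.μ⟩) + adSU2 ((GaugeField.plaqHol U₀ p)⁻¹ * U₀ ⟨p.src, p.μ⟩) (ζ ⟨p.src.shift p.μ, p.ν⟩) -
          adSU2 ((GaugeField.plaqHol U₀ p)⁻¹ * U₀ ⟨p.src, p.μ⟩ * U₀ ⟨p.src.shift p.μ, p.ν⟩ * (U₀ ⟨p.src.shift p.ν, p.μ⟩)⁻¹) (ζ ⟨p.src.shift p.ν, p.μ⟩) -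
          ζ ⟨p.src, p.ν⟩)) = lam (DM ζ) :=
  exists_multiplier_of_subm hJK U₀ hloc hMc hsurj (hfib_of_continuousAt_of_injOn hJK hU₀ hO hχ hcont)

end Organ

end Summit.QuantumFields.YangMills.Theorems.FluctuationComparisonRegPrIntLS2BetaChartedFibreLevelSet

end
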